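import Literature.Probability.Percolation.QuadCrossingSpaceZ2
import Literature.Probability.Percolation.QuadCrossingSpaceProofs
import Literature.Probability.Percolation.QuadCrossingMeasurability
import Literature.Probability.Percolation.FiniteEnergy
import Mathlib.Topology.MetricSpace.Thickening
import HarnessLib

/-!
# Discrete input to Schramm–Smirnov's Cor. 1.8: locality, measurability and independence of the
# quad-crossing events of bond percolation on `δℤ²`

Topic `Literature/Probability/Percolation`; first proofs file towards the named fact
`SchrammSmirnov2011_cor_1_8_noise` of `QuadCrossingNoise.lean` (O. Schramm, S. Smirnov, *On the
scaling limits of planar percolation*, Ann. Probab. 39 (2011), arXiv:1101.5820, Cor. 1.8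
"Percolation is a noise": for a domain cut in two, the crossing `σ`-fields of the two pieces are
independent and together generate everything).  The independence half is, in the source, the
discrete product structure ((1.1) on p. 4 of the arXiv version: "when `V` is decomposed into two
disjoint subsets, we obviously have `𝓕_V = 𝓕_{V₁} × 𝓕_{V₂}`") passed to the scaling limit.  This
file supplies the discrete statement for the tree's encoding `ω ↦ ω_δ = z2QuadConfig D δ ω ∈ ℋ_D`
(`QuadCrossingSpaceZ2.lean`) of critical bond percolation `P_{1/2} = bondPercolation (zdGraph 2) half`:

* `determinedBy_preimage_crossedEvent` — **locality**: the event `{ω : Q ∈ ω_δ}` (`Q` a quad of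
  `D`; `ω_δ` is the CLOSURE in `𝒬_D` of the quads crossed inside the drawn open edges, so the event
  reads "quads arbitrarily close to `Q` are crossed") is determined by the edges whose drawn
  segment meets the `ε`-neighbourhood of `[Q]`, for every `ε > 0`;
* `measurableSet_preimage_crossedEvent`, `measurable_z2QuadConfig` — hence it is a cylinder event,
  and by Theorem 1.4 (2) (`QuadConfig.generateFrom_notCrossed_eq_borel_of_esb` with `(3.2)`,
  `Quad.mem_closure_setOf_strictlyDominated`) the encoding `ω ↦ ω_δ` is Borel measurable for
  `δ > 0`, so that `μ_δ = z2QuadLaw D δ` is a genuine probability measure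
  (`isProbabilityMeasure_z2QuadLaw_of_pos`; the definition file left this to a proofs file);
* `bondPercolation_preimage_inter_eq_mul`, `z2QuadLaw_inter_crossedEvent_eq_mul` — **discrete
  independence**: for two finite families of quads with disjoint (compact) unions of carriers, the
  joint crossing events are independent under `μ_δ` for all small `δ` (disjoint determining edge
  sets, `bondPercolation_inter_of_disjoint`).

No definition and no named fact is introduced.

## References

* [SchrammSmirnov2011] O. Schramm, S. Smirnov, Ann. Probab. 39 (2011) 1768–1814,
  arXiv:1101.5820, §1.1 (1.1), §1.3, Cor. 1.8.
* [Grimmett1999] G. Grimmett, *Percolation*, 2nd ed. (1999), §1.3 p. 10, §2.2 (product measure,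
  cylinder events).
-/

noncomputable section

open Set Filter Metric
open _root_.MeasureTheory _root_.ProbabilityTheory _root_.Topology
open Literature.Probability.LatticeModels

namespace Literature.Probability.Percolation

open QuadCrossing

variable {D : Set ℂ}

/-! ### Locality of the crossing events of `ω_δ` -/

/-- A quad uniformly `ε`-close to `Q` has its carrier in the closed `ε`-neighbourhood of `[Q]`.
[folklore] -/
theorem QuadCrossing.Quad.carrier_subset_cthickening_of_dist_le {Q Q' : Quad D} {ε : ℝ}
    (h : dist Q' Q ≤ ε) : Q'.carrier ⊆ cthickening ε Q.carrier := by
  rintro _ ⟨z, rfl⟩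
  exact mem_cthickening_of_dist_le _ (Q z) _ _ ⟨z, rfl⟩ ((Quad.dist_apply_le Q' Q z).trans h)

/-- **Locality of the drawn open edges.** If `E` contains every lattice edge whose drawn segment
meets `T`, then inside `T` the open edges of `ω` and of `ω ∩ E` draw the same set (the version of
`closure_inter_openEdgeUnion_eq_of_subset` for an arbitrary window `T`). [folklore] -/
theorem inter_openEdgeUnion_eq_inter_openEdgeUnion_inter {T : Set ℂ} {δ : ℝ}
    {E : Set (Sym2 (Site 2))}
    (hE : ∀ x y : Site 2, (zdGraph 2).Adj x y →
      (segment ℝ (meshPoint δ x) (meshPoint δ y) ∩ T).Nonempty → s(x, y) ∈ E)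
    (ω : BondConfig (Site 2)) :
    T ∩ openEdgeUnion δ ω = T ∩ openEdgeUnion δ (ω ∩ E) := by
  refine Subset.antisymm ?_ (inter_subset_inter_right _ (openEdgeUnion_mono δ inter_subset_left))
  rintro z ⟨hzT, hz⟩
  obtain ⟨x, y, hxy, hω, hzs⟩ := mem_openEdgeUnion_iff.1 hz
  exact ⟨hzT, mem_openEdgeUnion_iff.2 ⟨x, y, hxy, ⟨hω, hE x y hxy ⟨z, hzs, hzT⟩⟩, hzs⟩⟩

/-- A quad inside the window `T` is crossed inside the open edges of `ω` iff it is crossed inside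
those of `ω ∩ E` (`E` as in `inter_openEdgeUnion_eq_inter_openEdgeUnion_inter`). [folklore] -/
theorem exists_isCrossing_subset_openEdgeUnion_iff {T : Set ℂ} {δ : ℝ}
    {E : Set (Sym2 (Site 2))}
    (hE : ∀ x y : Site 2, (zdGraph 2).Adj x y →
      (segment ℝ (meshPoint δ x) (meshPoint δ y) ∩ T).Nonempty → s(x, y) ∈ E)
    {Q' : Quad D} (hQ'T : Q'.carrier ⊆ T) (ω : BondConfig (Site 2)) :
    (∃ K, Q'.IsCrossing K ∧ K ⊆ openEdgeUnion δ ω) ↔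
      ∃ K, Q'.IsCrossing K ∧ K ⊆ openEdgeUnion δ (ω ∩ E) := by
  refine ⟨?_, ?_⟩
  · rintro ⟨K, hK, hKω⟩
    refine ⟨K, hK, fun z hz => ?_⟩
    have hz' : z ∈ T ∩ openEdgeUnion δ ω := ⟨hQ'T (hK.2.2.1 hz), hKω hz⟩
    rw [inter_openEdgeUnion_eq_inter_openEdgeUnion_inter hE ω] at hz'
    exact hz'.2
  · rintro ⟨K, hK, hKω⟩
    exact ⟨K, hK, hKω.trans (openEdgeUnion_mono δ inter_subset_left)⟩

/-- **`Q ∈ ω_δ` unfolded**: quads arbitrarily close to `Q` have a crossing inside the drawn open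
edges (`ω_δ` is the closure of the raw crossed set). [cite: SchrammSmirnov2011, §1.3] -/
theorem mem_z2QuadConfig_iff {δ : ℝ} {ω : BondConfig (Site 2)} {Q : Quad D} :
    Q ∈ z2QuadConfig D δ ω ↔ ∀ r > 0, ∃ Q' : Quad D, dist Q' Q < r ∧
      ∃ K, Q'.IsCrossing K ∧ K ⊆ openEdgeUnion δ ω := by
  rw [← QuadConfig.mem_coe, coe_z2QuadConfig, Metric.mem_closure_iff]
  refine forall₂_congr fun r _ => ⟨?_, ?_⟩
  · rintro ⟨Q', hQ', hd⟩
    exact ⟨Q', by rwa [dist_comm], hQ'⟩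
  · rintro ⟨Q', hd, hQ'⟩
    exact ⟨Q', hQ', by rwa [dist_comm]⟩

/-- **Locality of `{ω : Q ∈ ω_δ}`.** If `E` contains every lattice edge whose drawn segment meets
the closed `ε`-neighbourhood of `[Q]` (`ε > 0`), then the event `{ω : Q ∈ ω_δ}` is determined by
the states of the edges in `E` (Grimmett 1999 §2.2: an event "defined in terms of the states of"
the edges in `E`). [cite: SchrammSmirnov2011, §1.3] -/
theorem determinedBy_preimage_crossedEvent (δ : ℝ) (Q : Quad D) {ε : ℝ} (hε : 0 < ε)
    {E : Set (Sym2 (Site 2))}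
    (hE : ∀ x y : Site 2, (zdGraph 2).Adj x y →
      (segment ℝ (meshPoint δ x) (meshPoint δ y) ∩ cthickening ε Q.carrier).Nonempty →
        s(x, y) ∈ E) :
    DeterminedBy (z2QuadConfig D δ ⁻¹' QuadConfig.crossedEvent Q) E := by
  have key : ∀ ω, ω ∈ z2QuadConfig D δ ⁻¹' QuadConfig.crossedEvent Q ↔
      ω ∩ E ∈ z2QuadConfig D δ ⁻¹' QuadConfig.crossedEvent Q := by
    intro ω
    simp only [mem_preimage, QuadConfig.mem_crossedEvent, mem_z2QuadConfig_iff]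
    refine ⟨fun h r hr => ?_, fun h r hr => ?_⟩
    · obtain ⟨Q', hd, hQ'⟩ := h (min r ε) (lt_min hr hε)
      refine ⟨Q', hd.trans_le (min_le_left _ _), ?_⟩
      rwa [← exists_isCrossing_subset_openEdgeUnion_iff hE
        (Quad.carrier_subset_cthickening_of_dist_le (hd.le.trans (min_le_right _ _)))]
    · obtain ⟨Q', hd, K, hK, hKω⟩ := h r hr
      exact ⟨Q', hd, K, hK, hKω.trans (openEdgeUnion_mono δ inter_subset_left)⟩
  rw [determinedBy_iff]
  intro ω ω' hωω'
  rw [key ω, key ω', hωω']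

/-- For `δ > 0` only finitely many lattice edges are drawn through a bounded window `T`: the set
of edges `s(x, y)`, `x ∼ y`, whose drawn segment `[δx, δy]` meets `T` is finite (both endpoints are
drawn within distance `δ` of `T`; `meshVertices_finite`). [folklore] -/
theorem finite_setOf_edge_meeting {T : Set ℂ} (hT : Bornology.IsBounded T) {δ : ℝ} (hδ : 0 < δ) :
    {e : Sym2 (Site 2) | ∃ x y : Site 2, (zdGraph 2).Adj x y ∧
      (segment ℝ (meshPoint δ x) (meshPoint δ y) ∩ T).Nonempty ∧ e = s(x, y)}.Finite := by
  have hVfin : (meshVertices (cthickening δ T) δ).Finite := meshVertices_finite hT.cthickening hδ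
  refine ((hVfin.prod hVfin).image fun p : Site 2 × Site 2 => s(p.1, p.2)).subset ?_
  have hmem : ∀ x y : Site 2, (zdGraph 2).Adj x y →
      ∀ z ∈ segment ℝ (meshPoint δ x) (meshPoint δ y), z ∈ T →
        x ∈ meshVertices (cthickening δ T) δ := fun x y hxy z hzs hzT => by
    rw [mem_meshVertices_iff]
    refine mem_cthickening_of_dist_le _ z _ _ hzT ?_
    rw [dist_comm, dist_eq_norm]
    exact (norm_sub_le_of_mem_segment hzs).trans
      ((norm_meshPoint_sub_meshPoint_le_of_adj δ hxy).trans (abs_of_pos hδ).le)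
  rintro e ⟨x, y, hxy, ⟨z, hzs, hzT⟩, rfl⟩
  exact ⟨(x, y), ⟨hmem x y hxy z hzs hzT, hmem y x hxy.symm z (by rwa [segment_symm]) hzT⟩, rfl⟩

/-! ### Measurability of the crossing events and of the encoding `ω ↦ ω_δ` -/

/-- **`{ω : Q ∈ ω_δ}` is an event** (`δ > 0`): it is determined by the finitely many edges drawn
through the `1`-neighbourhood of `[Q]`, hence a finite union of cylinders. [cite: SchrammSmirnov2011, §1.3] -/
theorem measurableSet_preimage_crossedEvent {δ : ℝ} (hδ : 0 < δ) (Q : Quad D) :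
    MeasurableSet (z2QuadConfig D δ ⁻¹' QuadConfig.crossedEvent Q) := by
  have hfin := finite_setOf_edge_meeting
    (Q.isCompact_carrier.isBounded.cthickening (δ := 1)) hδ
  have hdet : DeterminedBy (z2QuadConfig D δ ⁻¹' QuadConfig.crossedEvent Q)
      {e : Sym2 (Site 2) | ∃ x y : Site 2, (zdGraph 2).Adj x y ∧
        (segment ℝ (meshPoint δ x) (meshPoint δ y) ∩ cthickening 1 Q.carrier).Nonempty ∧
          e = s(x, y)} :=
    determinedBy_preimage_crossedEvent δ Q one_pos fun x y hxy hne => ⟨x, y, hxy, hne, rfl⟩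
  rw [← hfin.coe_toFinset] at hdet
  exact hdet.measurableSet_of_finset

/-- **The encoding `ω ↦ ω_δ ∈ ℋ_D` is Borel measurable** for `D` open and `δ > 0`: by
Theorem 1.4 (2) the Borel `σ`-field of `ℋ_D` is generated by the `V^Q = {S : Q ∉ S}`, whose
preimages are the complements of the events `{ω : Q ∈ ω_δ}`.  (The definition file
`QuadCrossingSpaceZ2.lean` left this to a proofs file.) [cite: SchrammSmirnov2011, §1.3 and Thm. 1.4 (2)] -/
theorem measurable_z2QuadConfig (hD : IsOpen D) {δ : ℝ} (hδ : 0 < δ) :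
    Measurable (z2QuadConfig D δ) := by
  have hesb := fun Q : Quad D => Quad.mem_closure_setOf_strictlyDominated hD Q
  have hgen := QuadConfig.generateFrom_notCrossed_eq_borel_of_esb hesb dense_univ
  have key : @Measurable _ _ _
      (MeasurableSpace.generateFrom
        ((fun Q => QuadConfig.notCrossed Q) '' (univ : Set (Quad D))))
      (z2QuadConfig D δ) :=
    measurable_generateFrom fun t ht => by
      obtain ⟨Q, -, rfl⟩ := ht
      change MeasurableSet (z2QuadConfig D δ ⁻¹' QuadConfig.notCrossed Q)
      rw [← QuadConfig.compl_crossedEvent, preimage_compl]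
      exact (measurableSet_preimage_crossedEvent hδ Q).compl
  rw [hgen] at key
  exact key

/-- Hence **`μ_δ = z2QuadLaw D δ` is a probability measure** for `D` open and `δ > 0` ("a
percolation model … induces a probability measure `μ_η` on `ℋ`"). [cite: SchrammSmirnov2011, §1.3] -/
theorem isProbabilityMeasure_z2QuadLaw_of_pos (hD : IsOpen D) {δ : ℝ} (hδ : 0 < δ) :
    IsProbabilityMeasure (z2QuadLaw D δ : Measure (QuadCrossingSpace D)) :=
  isProbabilityMeasure_z2QuadLaw (measurable_z2QuadConfig hD hδ).aemeasurable

/-- For `D` open and `δ > 0`, `μ_δ(A)` is the `P_{1/2}`-probability of the preimage of the Borel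
set `A` under `ω ↦ ω_δ`. [cite: SchrammSmirnov2011, §1.3] -/
theorem z2QuadLaw_apply (hD : IsOpen D) {δ : ℝ} (hδ : 0 < δ) {A : Set (QuadCrossingSpace D)}
    (hA : MeasurableSet A) :
    (z2QuadLaw D δ : Measure (QuadCrossingSpace D)) A =
      bondPercolation (zdGraph 2) half (z2QuadConfig D δ ⁻¹' A) := by
  rw [toMeasure_z2QuadLaw, Measure.map_apply (measurable_z2QuadConfig hD hδ) hA]

/-! ### Independence of the crossing events of separated families of quads -/

/-- A finite intersection of events each determined by `F` is determined by `F`. [folklore] -/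
theorem DeterminedBy.biInter_finset_const {ι κ : Type*} {A : κ → Set (Set ι)} {F : Set ι}
    (s : Finset κ) (h : ∀ k ∈ s, DeterminedBy (A k) F) : DeterminedBy (⋂ k ∈ s, A k) F := by
  rw [determinedBy_iff]
  intro ω ω' hω
  simp only [mem_iInter]
  exact forall₂_congr fun k hk => (determinedBy_iff _ _).1 (h k hk) ω ω' hω

/-- Two points of a drawn lattice edge `[δx, δy]` (`x ∼ y`, `δ > 0`) are within `2δ` of each
other. [folklore] -/
theorem dist_le_of_mem_segment_meshPoint {δ : ℝ} (hδ : 0 < δ) {x y : Site 2}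
    (hxy : (zdGraph 2).Adj x y) {z w : ℂ} (hz : z ∈ segment ℝ (meshPoint δ x) (meshPoint δ y))
    (hw : w ∈ segment ℝ (meshPoint δ x) (meshPoint δ y)) : dist z w ≤ 2 * δ := by
  have hb := (norm_meshPoint_sub_meshPoint_le_of_adj δ hxy).trans (abs_of_pos hδ).le
  calc dist z w ≤ dist z (meshPoint δ x) + dist w (meshPoint δ x) := dist_triangle_right _ _ _
    _ ≤ δ + δ := by
        rw [dist_eq_norm, dist_eq_norm]
        exact add_le_add ((norm_sub_le_of_mem_segment hz).trans hb)
          ((norm_sub_le_of_mem_segment hw).trans hb)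
    _ = 2 * δ := by ring

/-- **Separated windows see disjoint sets of edges.** If the `(ε + 2δ)`-neighbourhood of `T₁` misses
the `ε`-neighbourhood of `T₂` (`ε ≥ 0`, mesh `δ > 0`), then no lattice edge is drawn through both
`ε`-neighbourhoods. [folklore] -/
theorem disjoint_setOf_edge_meeting {T₁ T₂ : Set ℂ} {ε δ : ℝ} (hε : 0 ≤ ε) (hδ : 0 < δ)
    (h : Disjoint (cthickening (2 * δ + ε) T₁) (cthickening ε T₂)) :
    Disjoint
      {e : Sym2 (Site 2) | ∃ x y : Site 2, (zdGraph 2).Adj x y ∧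
        (segment ℝ (meshPoint δ x) (meshPoint δ y) ∩ cthickening ε T₁).Nonempty ∧ e = s(x, y)}
      {e : Sym2 (Site 2) | ∃ x y : Site 2, (zdGraph 2).Adj x y ∧
        (segment ℝ (meshPoint δ x) (meshPoint δ y) ∩ cthickening ε T₂).Nonempty ∧ e = s(x, y)} := by
  rw [Set.disjoint_left]
  rintro e ⟨x, y, hxy, ⟨z, hzs, hz⟩, rfl⟩ ⟨x', y', -, ⟨w, hws, hw⟩, he⟩
  -- the two representations draw the same segment
  have hws' : w ∈ segment ℝ (meshPoint δ x) (meshPoint δ y) := by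
    rcases Sym2.eq_iff.1 he with ⟨rfl, rfl⟩ | ⟨rfl, rfl⟩
    · exact hws
    · rwa [segment_symm]
  have hwz : dist w z ≤ 2 * δ := dist_le_of_mem_segment_meshPoint hδ hxy hws' hzs
  have hw₁ : w ∈ cthickening (2 * δ + ε) T₁ := by
    have : w ∈ cthickening (2 * δ) (cthickening ε T₁) := mem_cthickening_of_dist_le w z _ _ hz hwz
    exact cthickening_cthickening_subset (by positivity) hε T₁ this
  exact Set.disjoint_left.1 h hw₁ hw

/-- **Discrete independence of separated crossing events.**  Let `F₁`, `F₂` be finite families of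
quads of `D` whose unions of carriers are disjoint.  Then for all sufficiently small meshes
`δ > 0` the events "every quad of `F₁` belongs to `ω_δ`" and "every quad of `F₂` belongs to `ω_δ`"
are independent under `P_{1/2}`: they are determined by disjoint sets of edges (those drawn through
small neighbourhoods of the two compact unions), and `P_{1/2}` is a product measure
(`bondPercolation_inter_of_disjoint`; Schramm–Smirnov (1.1): "`𝓕_V = 𝓕_{V₁} × 𝓕_{V₂}`").
[cite: SchrammSmirnov2011, §1.1 (1.1) and Cor. 1.8] -/
theorem bondPercolation_preimage_inter_eq_mul (F₁ F₂ : Finset (Quad D))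
    (hdisj : Disjoint (⋃ Q ∈ F₁, Q.carrier) (⋃ Q ∈ F₂, Q.carrier)) :
    ∃ δ₀ > 0, ∀ δ, 0 < δ → δ < δ₀ →
      bondPercolation (zdGraph 2) half
          ((⋂ Q ∈ F₁, z2QuadConfig D δ ⁻¹' QuadConfig.crossedEvent Q) ∩
            ⋂ Q ∈ F₂, z2QuadConfig D δ ⁻¹' QuadConfig.crossedEvent Q) =
        bondPercolation (zdGraph 2) half
            (⋂ Q ∈ F₁, z2QuadConfig D δ ⁻¹' QuadConfig.crossedEvent Q) *
          bondPercolation (zdGraph 2) half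
            (⋂ Q ∈ F₂, z2QuadConfig D δ ⁻¹' QuadConfig.crossedEvent Q) := by
  have hK₁ : IsCompact (⋃ Q ∈ F₁, Q.carrier) :=
    F₁.isCompact_biUnion fun Q _ => Q.isCompact_carrier
  have hK₂ : IsCompact (⋃ Q ∈ F₂, Q.carrier) :=
    F₂.isCompact_biUnion fun Q _ => Q.isCompact_carrier
  obtain ⟨ε, hε, hdisjε⟩ := hdisj.exists_cthickenings hK₁ hK₂.isClosed
  refine ⟨ε / 4, by positivity, fun δ hδ hδε => ?_⟩
  have hε2 : (0 : ℝ) ≤ ε / 2 := by positivity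
  -- the determining edge sets are disjoint
  have hE : Disjoint
      {e : Sym2 (Site 2) | ∃ x y : Site 2, (zdGraph 2).Adj x y ∧
        (segment ℝ (meshPoint δ x) (meshPoint δ y) ∩
          cthickening (ε / 2) (⋃ Q ∈ F₁, Q.carrier)).Nonempty ∧ e = s(x, y)}
      {e : Sym2 (Site 2) | ∃ x y : Site 2, (zdGraph 2).Adj x y ∧
        (segment ℝ (meshPoint δ x) (meshPoint δ y) ∩
          cthickening (ε / 2) (⋃ Q ∈ F₂, Q.carrier)).Nonempty ∧ e = s(x, y)} := by
    refine disjoint_setOf_edge_meeting hε2 hδ (hdisjε.mono ?_ ?_)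
    · exact cthickening_mono (by linarith) _
    · exact cthickening_mono (by linarith) _
  -- each joint crossing event is determined by its edge set
  have hdet : ∀ F : Finset (Quad D),
      DeterminedBy (⋂ Q ∈ F, z2QuadConfig D δ ⁻¹' QuadConfig.crossedEvent Q)
        {e : Sym2 (Site 2) | ∃ x y : Site 2, (zdGraph 2).Adj x y ∧
          (segment ℝ (meshPoint δ x) (meshPoint δ y) ∩
            cthickening (ε / 2) (⋃ Q ∈ F, Q.carrier)).Nonempty ∧ e = s(x, y)} := fun F =>
    DeterminedBy.biInter_finset_const F fun Q hQ =>
      determinedBy_preimage_crossedEvent δ Q (half_pos hε) fun x y hxy ⟨z, hzs, hz⟩ =>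
        ⟨x, y, hxy, ⟨z, hzs, cthickening_subset_of_subset _
          (Finset.subset_set_biUnion_of_mem hQ) hz⟩, rfl⟩
  exact bondPercolation_inter_of_disjoint (zdGraph 2) half hE (hdet F₁) (hdet F₂)
    (F₁.measurableSet_biInter fun Q _ => measurableSet_preimage_crossedEvent hδ Q)
    (F₂.measurableSet_biInter fun Q _ => measurableSet_preimage_crossedEvent hδ Q)

/-- **Discrete independence on `ℋ_D`.**  For `D` open and finite families `F₁`, `F₂` of quads of
`D` with disjoint unions of carriers, for all small meshes `δ > 0` the joint crossing events
`⋂_{Q ∈ F₁} ⊞_Q` and `⋂_{Q ∈ F₂} ⊞_Q` are independent under `μ_δ = z2QuadLaw D δ`.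
[cite: SchrammSmirnov2011, §1.1 (1.1) and Cor. 1.8] -/
theorem z2QuadLaw_inter_crossedEvent_eq_mul (hD : IsOpen D) (F₁ F₂ : Finset (Quad D))
    (hdisj : Disjoint (⋃ Q ∈ F₁, Q.carrier) (⋃ Q ∈ F₂, Q.carrier)) :
    ∃ δ₀ > 0, ∀ δ, 0 < δ → δ < δ₀ →
      (z2QuadLaw D δ : Measure (QuadCrossingSpace D))
          ((⋂ Q ∈ F₁, QuadConfig.crossedEvent Q) ∩ ⋂ Q ∈ F₂, QuadConfig.crossedEvent Q) =
        (z2QuadLaw D δ : Measure (QuadCrossingSpace D)) (⋂ Q ∈ F₁, QuadConfig.crossedEvent Q) *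
          (z2QuadLaw D δ : Measure (QuadCrossingSpace D)) (⋂ Q ∈ F₂, QuadConfig.crossedEvent Q) := by
  obtain ⟨δ₀, hδ₀, h⟩ := bondPercolation_preimage_inter_eq_mul F₁ F₂ hdisj
  refine ⟨δ₀, hδ₀, fun δ hδ hδ' => ?_⟩
  have h₁ : MeasurableSet (⋂ Q ∈ F₁, QuadConfig.crossedEvent (D := D) Q) :=
    F₁.measurableSet_biInter fun Q _ => QuadConfig.measurableSet_crossedEvent Q
  have h₂ : MeasurableSet (⋂ Q ∈ F₂, QuadConfig.crossedEvent (D := D) Q) :=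
    F₂.measurableSet_biInter fun Q _ => QuadConfig.measurableSet_crossedEvent Q
  rw [z2QuadLaw_apply hD hδ (h₁.inter h₂), z2QuadLaw_apply hD hδ h₁, z2QuadLaw_apply hD hδ h₂,
    preimage_inter, preimage_iInter₂, preimage_iInter₂]
  exact h δ hδ hδ'

end Literature.Probability.Percolation
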